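import Summits.BirchSwinnertonDyer.BirchSwinnertonDyer.Theorems.ManinLocalTwoThreePShiftTransferBase
import Summits.BirchSwinnertonDyer.Rank1Residual.ManinAdditive.PrimeShiftEqualiserLaw
import HarnessLib

/-!
# The prime-generic shift-equaliser law BY NAME at `v_p(N) ≤ 1`, every prime `p ≥ 5`
# (route `ManinLocalTwoThree`, cell bsd-f2-manin; cruxes C2 stmt-BirchSwinnertonDyer-22967 / C3 stmt-…-22968; LEAD seat p1 gen 12; typer g17's
# `…/ManinAdditive/PrimeShiftEqualiserLaw.lean` (T-p1-g11-2): law `ShiftEqualiser.PrimeShiftInvariantIsDiamond`, schema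
# `ShiftEqualiser.ShiftInvariantIsDiamondAt K t N`)

The seat's prime-generic transfer files (`…PShiftTransfer{,Pair,Step,Base}.lean`) speak p3's `TwoShift.IsAdd / IsDiamond` and the seat's
`PShiftTransfer.IsShiftEigenP p ε`; the typer's law speaks `ShiftEqualiser.IsAdd / IsShiftInvariant (p : ℤ) / IsDiamond`.  The bodies agree
(`Iff.rfl` up to `one_mul`), so: **`ShiftEqualiser.ShiftInvariantIsDiamondAt (ZMod p) p N` holds for every prime `p ≥ 5` and every level
`N ≥ 1` with `p² ∤ N`** (`shiftInvariantIsDiamondAt_of_not_sq_dvd`) — the typer's node `PrimeShiftInvariantIsDiamondAtPrime p` restricted to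
`v_p(N) ≤ 1`: `p ∤ N` by p2's Serre base, `p ∥ N` by the seat's transfer (`shiftInvariantIsDiamondAtP_prime_mul`).  OPEN (by name): `p ≥ 5`,
`p² ∣ N` (the `K_{p,p}` steps; p2's `HeisenbergFiveLe.exists_heisenbergLift_of_five_le` is the lift, the engine at a non-normal `A = {p ∣ b}` is
not in the tree).  Nothing about BSD, Manin's conjecture or C2/C3 is proved here.
[cite: DarmonDiamondTaylor1995, Lemma 4.28 (p. 135) (shape: degeneracy maps on `Γ₀`)]
-/

set_option autoImplicit false
set_option linter.dupNamespace false

open scoped MatrixGroups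

open CongruenceSubgroup Matrix.SpecialLinearGroup
  Summit.BirchSwinnertonDyer.Rank1Residual.ManinAdditive.NineShiftEqualiser

namespace Summit.BirchSwinnertonDyer.BirchSwinnertonDyer.Theorems.ManinLocalTwoThree

namespace PShiftTransfer

open Summit.BirchSwinnertonDyer.Rank1Residual.ManinAdditive

variable {p : ℕ} {K : Type*} [CommRing K] {N : ℕ}

/-- The seat's `IsShiftEigenP p 1` is the typer's `ShiftEqualiser.IsShiftInvariant (p : ℤ)` (up to `one_mul`). [folklore] -/
theorem isShiftEigenP_one_iff (φ : Gamma0 N → K) :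
    IsShiftEigenP p (1 : K) φ ↔ ShiftEqualiser.IsShiftInvariant (p : ℤ) φ := by
  constructor
  · intro h a b c d hdet hc
    have := h a b c d hdet hc
    rwa [one_mul] at this
  · intro h a b c d hdet hc
    rw [one_mul]
    exact h a b c d hdet hc

/-- The seat's schema `ShiftInvariantIsDiamondAtP p N K` is the typer's `ShiftEqualiser.ShiftInvariantIsDiamondAt K p N`. [folklore] -/
theorem shiftInvariantIsDiamondAtP_iff (p N : ℕ) (K : Type*) [CommRing K] :
    ShiftInvariantIsDiamondAtP p N K ↔ ShiftEqualiser.ShiftInvariantIsDiamondAt K (p : ℤ) N := by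
  constructor
  · intro h φ hadd hinv
    exact h φ hadd ((isShiftEigenP_one_iff φ).mpr hinv)
  · intro h φ hadd hinv
    exact h φ hadd ((isShiftEigenP_one_iff φ).mp hinv)

/-- **The prime-generic equaliser law at `v_p(N) ≤ 1`, BY NAME, every prime `p ≥ 5`:** for `N ≥ 1` with `p² ∤ N`, every additive
`p`-shift-invariant `φ : Γ₀(N) → ℤ/p` is a diamond class (`ShiftEqualiser.ShiftInvariantIsDiamondAt (ZMod p) p N`). [new: composition
of p2's Serre base and the seat's transfer] -/
theorem shiftInvariantIsDiamondAt_of_not_sq_dvd [Fact p.Prime] (h5 : 5 ≤ p) (hN : 0 < N) (hsq : ¬ p ^ 2 ∣ N) :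
    ShiftEqualiser.ShiftInvariantIsDiamondAt (ZMod p) (p : ℤ) N := by
  have hp : p.Prime := Fact.out
  have hpK : ((p : ℕ) : ZMod p) = 0 := ZMod.natCast_self p
  rw [← shiftInvariantIsDiamondAtP_iff]
  by_cases hpN : p ∣ N
  · obtain ⟨M, rfl⟩ := hpN
    have hM : 0 < M := Nat.pos_of_mul_pos_left hN
    have hpM : ¬ p ∣ M := fun h => hsq (by obtain ⟨k, rfl⟩ := h; exact ⟨k, by ring⟩)
    exact shiftInvariantIsDiamondAtP_prime_mul hpK h5 hM hpM
  · exact shiftInvariantIsDiamondAtP_of_not_dvd hpK hN hpN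

end PShiftTransfer

end Summit.BirchSwinnertonDyer.BirchSwinnertonDyer.Theorems.ManinLocalTwoThree
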